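import Literature.MathematicalPhysics.QuantumFieldTheory.Balaban1983to89.B8Thm4ExistsZd3BdryBeta
import Literature.MathematicalPhysics.QuantumFieldTheory.Balaban1983to89.B8Prop6CubeMemberGaugedBdryBetaExists
import Literature.MathematicalPhysics.QuantumFieldTheory.Balaban1983to89.B8Prop6CubeMemberOfThm33Beta

/-!
# `Balaban1983to89.B8Prop6CubeMemberOfThm33BetaExists` — [Balaban1985RegularSpaces] PROPOSITION 6 (p. 99) ON NODE 00's CUBE MEMBER `Node00.zdCub`
# FROM [Balaban1985BackgroundPropagators] THEOREM 3.3 BY NAME, EDITION β, WITHOUT PROPOSITION 5's UNIQUENESS SOCKET — the N06→N05 junction knit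
# of the cube road on Theorem 4's EXISTENCE half: sockets = Prop. 5 ∃ base ∕ ∃ step + dag-n06-b's all-levels β family; `SockP5u`, `cu` GONE

statement-level skeleton of published theorems with citation tags; proofs where landed; nothing here is a claim about the
Yang–Mills mass gap

PDF held: `paper:balaban1985-cmp99-regular-spaces-gauge-fixing`; p. 99 [PDF 25] re-read this session (text layer p0025): *«If 7dL²Mα₀ ≤ c₁, then the
assumptions of Theorem 4 are satisfied for the pair of configurations 1, U₀″, thus there exists a gauge transformation u such that U₁ = U₀″^{u⁻¹} satisfies the
conditions (1.36)–(1.39)»*; Theorem 4 p. 88 («there exists exactly one …»: existence pp. 88–94 from Prop. 5's EXISTENCE (1.107)–(1.108) and (1.59);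
uniqueness p. 95 from Prop. 5's uniqueness (1.109)).  [4] = `[Balaban1985BackgroundPropagators]` Thm 3.3 p. 399, (3.16) p. 393.

CITATION HEADER (lean-in-tree rule).  Cell `pub-ymgap` (HUMAN RULING D-0062, Track A), DAG node N05 = [B8], seat `pub-ymgap-dag-n05-e` g9 (R141 (C) row s3b —
Proposition 6 at NODE 00's cube member; the N06→N05 cube-road junction in the socket of record, dag-lead RULING №189 (2)).  WHY THIS FILE.  The junction knit of
record `B8Prop6CubeMemberOfThm33Beta.prop6Printed_zdCub_of_thm33β(_uniform)` (p550198 ∕ p563537) and its binder-agnostic consumer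
`B8LeafKnitZd3CubBdryBeta.prop6Printed_zdCub_of_sockD4βFamily` (p547598) carry Proposition 5's THREE sockets, including the UNIQUENESS socket `SockP5u … cP cu`,
because they sit on Theorem 4 WHOLE (`B8Thm4ConcreteBdryBeta.thm4Printed_zd3_map_bdryβ`).  dag-n05-d g9 (bus 2026-08-27 19:53Z, consumer of these letters in
`Summits/…/BalabanUVNodesN05SubBHKnitUnivOfThm33P6Beta`) located: «`SockP5u` [at the cube members] has NO in-tree provider — n04-b's `sockP5uE_of_lettersU` needs
`Ω₀ = ℤᵈ`; print's Prop. 6 needs no uniqueness».  THIS FILE re-runs the two consumers and the junction knit on Theorem 4's EXISTENCE HALF in edition β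
(this seat's `B8Thm4ExistsZd3BdryBeta.thm4ExistsBody_zd3_map_bdryβ` + `B8Prop6CubeMemberGaugedBdryBetaExists.prop6Printed_zdCub_of_thm4Exists_b9Dβ_d4`):
§1 ★ `prop6Printed_zdCub_bdryβ₃_d4` — `B8.Prop6Printed d L (5dL·inp.B₀) c₁ (zdCub ∘ f)` from FOUR β sockets on the cube sub-family: `SockP5base`, `SockP5`, the
   two-line β (1.59) socket of Theorem 4's frame (INLINE) and, per cube of `f`, the four-line β socket of Proposition 3's frame (p547598's
   `prop6Printed_zdCub_bdry₅β_d4` MINUS `SP5u`).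
§2 ★★ `prop6Printed_zdCub_of_sockD4βFamily₃` — the BINDER-AGNOSTIC consumer: an all-levels `SockB9P3D4β L B₀ B_∂ cP₉` family on the cube sub-family + Prop. 5's
   TWO EXISTENCE sockets at `B₀ˢ = max{max{1, B₀}, 4B_∂∕(dL − 1)}` ⟹ `∃ c₁ > 0, ∀ f, B8.Prop6Printed d L (5dL·B₀ˢ) c₁ (zdCub ∘ f)` (p547598 §4 MINUS `SP5u`, `cu`).
§3 ★★★ `prop6Printed_zdCub_of_thm33β₃` — THE JUNCTION KNIT: `B9.Thm33Printed` BY NAME + dag-n06-b's six member-local binders in edition β on the cube sub-family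
   ⟹ `∃ B₀ˢ ≥ 1, ∀ {B₀′ cP} > 0, SockP5base@(B₀ˢ, B₀′, cP) → SockP5@(B₀ˢ, B₀′, cP) → ∃ c₁ > 0, ∀ f, B8.Prop6Printed d L (5dL·B₀ˢ) c₁ (zdCub ∘ f)` (dag-n05-d's plug
   shape, p563537 §3, MINUS `SP5u`, `cu`); ★★ `prop6Printed_zdCub_of_thm33β₃_hall` — the same with the β socket family `hall` EXPORTED (`B₀ᴰ ≤ B₀ˢ`,
   `4B_∂ ≤ (dL − 1)B₀ˢ`; dag-n05-d CONSUMER-NOTE-2); record form ★ `prop6Printed_cubB8OfRecord_of_thm33β₃` on `Node00.cubB8OfRecord θ`.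
Kind «kernel-checked proof», theorems only, no `def`; proofs = the landed ones with the uniqueness argument place removed.

HONEST SCOPE ∕ A6 (director-ym №189 (3)).  Compositions by name; nothing of [4] or of Propositions 3∕5 is proved.  Every socket∕binder is a HYPOTHESIS: the
member-local binder set {`DictAt`, `Prop6At`, `InvAt`, `CurvAt`, `LandauAt`, `AvgAtβ`, `Margin2`, Thm 3.3's block} behind §3 is INHABITED at every cube member at
truncation `m = 0` by dag-n06-b's `B9SupplySockB9P3ZdBeta.Witness.binders_inhabited_cube_zero` (whence `Witness.sockB9P3D4β_at_nonvacuous_cube_zero`); NOT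
witnessed: the binders at `m ≥ 1` ([4] Sect. A + Thm 3.11, object-bound), `B9.Thm33Printed` (N06's node), Proposition 5's two EXISTENCE sockets (N05's Prop.-5
lane: `B8SockHFPAssembly.sockHFP₀_body_of_join` ∕ `sockHFP_body_of_join` modulo the letters) — no joint-satisfiability claim of the full ∀-m list.  The β sockets
are FALSE below an absolute threshold in `B₀` (boundary pure-gauge mode; declared in every β file; kernel threshold `B₀ ≥ d + 1` at cube members, ref-E g10
READ-12) — the supplier's `B₀` absorbs it.  WHAT LEAVES THE DISPLAY: `SockP5u` and its radius `cu` (Theorem 4's uniqueness is not an input of Proposition 6).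
NODE 00's carrier `CubeB8` is more permissive than print's p. 98 cubes (this seat's LOCATED-CARRIER, bus 2026-08-27 19:21Z) — unchanged here.  Count-neutral;
N05 NOT discharged; one finite `𝕋⁴` programme at fixed `ε`, Bałaban as printed; nothing continuum ∕ ℝ⁴ ∕ OS ∕ mass-gap ∕ Clay.  No `sorry`, no `def`, no
`instance`, no `notation`.  Unit `pub-ymgap-dag-n05-e` (g9), 2026-08-27.

RELATED IN THE TREE, NOT DUPLICATED: `B8LeafKnitZd3CubBdryBeta` (p547598: the `Thm4Printed` road with `SP5u`; USED: `bdryLayer_cubeSubfamily`, `sockB9P3D4β_mono_B₀`,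
`sockH59Dβ_of_allLevelsD4β`), `B8Prop6CubeMemberOfThm33Beta` (p550198 ∕ p563537: the knit with `SP5u`; imports reused), `B9SupplySockB9P3ZdBeta` (dag-n06-b p541339:
USED `sockB9P3D4β_allLevels_of_thm33_on`), `B8Prop6CubeMemberExists` ∕ `B8Thm4HalvesZd3` (dag-n05-c g2: the existence half in the R-d currency).
-/

noncomputable section

open NormedSpace

namespace Literature.MathematicalPhysics.QuantumFieldTheory.Balaban1983to89.B8Prop6CubeMemberOfThm33BetaExists

open MatrixLog B7Prop1Explicit B7Prop2Explicit B7Prop1Local B7Eq92Concrete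
open B7Prop4GeneralLevels (logCovIter linCovIter)
open B8Ineq132 (InAk covDerivFwd BondTouches)
open B8Eq119TwistedAxial (Restr129 InAx)
open B8Eq140Level (SideTouches)
open B8Eq146AExpansion (iEta plaqCovDeriv)
open B8Eq143PlaqExpansion (pdiv)
open B8Eq155JBound (Jcur wsup)
open B8ScaledSupNorm (bondNorm msup)
open B8Eq184Proof (gaugeExp cfgExp)
open B8Eq138LandauZd (IsLandau138W logCfg covLap)
open B8Lemma1NonAbelian (mulCfg)
open B8Ineq130 (tlo thi)
open B8LeafModelZd (ZdIdx SockP5base SockP5)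
open B8LeafModelZdOfHFP (sockP5base_anti sockP5_anti)
open B8LeafModelZd3 (zdGF3)
open B8Eq131CubesAdmissible (cubeFam)
open B8CubeMemberZd (cubeLamS cubeLamB hΩ_cubeFam hbox_cubeLamB hclass_cubeLamB htower_cubeLam hpart_cubeLam)
open B9SupplySockB9P3ZdLetters (OpsZd)
open B9SupplySockB9P3ZdLettersOmega (Margin2 margin2_cubeFam)
open B9SupplySockB9P3ZdAt (DictAt Prop6At InvAt CurvAt LandauAt)
open B9SupplySockB9P3ZdBeta (CrossB SockB9P3D4β AvgAtβ sockB9P3D4β_allLevels_of_thm33_on)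
open B8Thm4ExistsZd3BdryBeta (thm4ExistsBody_zd3_map_bdryβ)
open B8Prop6CubeMemberGaugedBdryBetaExists (prop6Printed_zdCub_of_thm4Exists_b9Dβ_d4)
open B8LeafKnitZd3CubBdryBeta (bdryLayer_cubeSubfamily sockB9P3D4β_mono_B₀ sockH59Dβ_of_allLevelsD4β)
open Node00 (CubeB8 zdCub)

-- `Site` alone could resolve to the torus sites of `Setup.lean`; re-export the `ℤ^d` sites of `B7Prop1Explicit`.
export B7Prop1Explicit (Site)

variable {d : ℕ}

variable {𝔸 : Type} [CStarAlgebra 𝔸] [Nontrivial 𝔸]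

/-! ## §1 Proposition 6 on `zdCub ∘ f` from the FOUR β existence-road sockets on the cube sub-family (no `SockP5u`) -/

/-- ★ **`B8.Prop6Printed d L (5dL·inp.B₀) c₁` ON NODE 00's `zdCub` FROM FOUR β SOCKETS ON THE CUBE SUB-FAMILY — NO UNIQUENESS SOCKET**: p547598's
`prop6Printed_zdCub_bdry₅β_d4` with Theorem 4 WHOLE replaced by its EXISTENCE HALF (`thm4ExistsBody_zd3_map_bdryβ` into `prop6Printed_zdCub_of_thm4Exists_b9Dβ_d4`):
Proposition 5 ∃ base ∕ ∃ step (`SockP5base`, `SockP5`), the two-line β (1.59) socket of Theorem 4's frame at every truncation (INLINE: support clause, `|B₁|β`,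
exterior-collar term `B_∂·Φ₀`), and per cube of `f` the four-line β socket of Proposition 3's frame; ONE threshold `c₁(d, L, B₀, B₀′, c_P, c_{B9}, B_∂)`; the
boundary-layer law discharged at the cubes (`bdryLayer_cubeSubfamily`).  `β := 0`, `len := 0` (the Hölder letters of `zdGF3` are not read by Proposition 6).
[cite: Balaban1985RegularSpaces, Prop. 6 p.99, Thm 4 p.88, Prop. 3 p.87, Prop. 5 (1.107)–(1.108) p.94, (1.59) p.86, (1.31) p.82, (1.131) p.99] -/
theorem prop6Printed_zdCub_bdryβ₃_d4 (hd2 : 2 ≤ d) {L : ℕ} (hL : 2 ≤ L) (inp : B8.B9Inputs) {C₂ cB9 cP Bbd : ℝ}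
    (hB : 2 ≤ 5 * (d : ℝ) * L * inp.B₀) (hC₂ : 2097152 * ((d : ℝ) + 1) ^ 2 ≤ C₂) (hcB9 : 0 < cB9) (hcP : 0 < cP)
    (hBbd : 0 ≤ Bbd) (hBd : 4 * Bbd ≤ ((d : ℝ) * L - 1) * inp.B₀)
    (SP5base : ∀ i : {i : ZdIdx d L // ∃ (a : Site d) (M ρ : ℕ), L ≤ ρ ∧ ρ ≤ M ∧ 11 * d < M ∧ L ≤ d * M ∧
        i.Ω = cubeFam false L a M ρ i.k ∧ i.Λs = cubeLamS L a M ρ i.k ∧ i.Λb = cubeLamB L a M ρ i.k}, SockP5base (𝔸 := 𝔸) L inp.B₀ inp.B₀' cP i.1.η i.1.k i.1.Ω i.1.Λs)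
    (SP5 : ∀ i : {i : ZdIdx d L // ∃ (a : Site d) (M ρ : ℕ), L ≤ ρ ∧ ρ ≤ M ∧ 11 * d < M ∧ L ≤ d * M ∧
        i.Ω = cubeFam false L a M ρ i.k ∧ i.Λs = cubeLamS L a M ρ i.k ∧ i.Λb = cubeLamB L a M ρ i.k}, SockP5 (𝔸 := 𝔸) L inp.B₀ inp.B₀' cP i.1.η i.1.k i.1.Ω i.1.Λs)
    (SH59Dβ : ∀ i : {i : ZdIdx d L // ∃ (a : Site d) (M ρ : ℕ), L ≤ ρ ∧ ρ ≤ M ∧ 11 * d < M ∧ L ≤ d * M ∧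
        i.Ω = cubeFam false L a M ρ i.k ∧ i.Λs = cubeLamS L a M ρ i.k ∧ i.Λb = cubeLamB L a M ρ i.k},
      (∀ α₀ α₁ : ℝ, 0 < α₀ → 0 < α₁ → α₀ + α₁ ≤ cP →
        ∀ U₀ U' : Site d → Fin d → 𝔸ˣ, (∀ x κ, U₀ x κ ∈ unitaryUnits 𝔸) → (∀ x κ, U' x κ ∈ unitaryUnits 𝔸) →
        InAk L i.1.k i.1.η α₀ i.1.Ω U₀ → InAk L i.1.k i.1.η α₀ i.1.Ω (mulCfg U' U₀) → (∀ m, m ≤ i.1.k → InAx L m (i.1.Λs m) U₀ (mulCfg U' U₀)) →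
        (∀ j, j ≤ i.1.k → ∀ (z : Site d) (μ : Fin d), (∀ x, InBox (loK L j z) (bondHiK L j z μ) x → x ∈ i.1.Ω j) →
          ‖(avgIter L (mulCfg U' U₀) j z μ : 𝔸) - (avgIter L U₀ j z μ : 𝔸)‖ ≤ α₁) →
        (∀ b ∈ {b : Site d × Fin d | SideTouches (i.1.Ω 0) b.1 b.2}, ‖((U' b.1 b.2 : 𝔸ˣ) : 𝔸) - 1‖ ≤ α₁) →
        (∀ m, 1 ≤ m → m ≤ i.1.k → ∀ (u : Site d → 𝔸ˣ) (W : Site d → Fin d → 𝔸ˣ) (A' : Site d → Fin d → 𝔸),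
          (∀ x, u x ∈ unitaryUnits 𝔸) → (∀ x, x ∉ i.1.Ω 0 → u x = 1) → mgauge U₀ u W = U' → Restr129 L m (i.1.Λs m) U₀ u →
          IsLandau138W L m i.1.η (i.1.Ω 0) (i.1.Λs m) U₀ W → (∀ y τ, IsSelfAdjoint (A' y τ)) →
          (∀ j, j ≤ m → ∀ y τ, SideTouches (i.1.Ω j) y τ →
          W y τ = cfgExp i.1.η A' y τ ∧ ‖A' y τ‖ ≤ (2 * (L * (5 * (d : ℝ) * L * inp.B₀ * (α₀ + α₁))) + 8 * (8 * inp.B₀' * (5 * (d : ℝ) * L * inp.B₀) * (α₀ + α₁))) * ((L : ℝ) ^ j * i.1.η)⁻¹) →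
          (∀ y τ, (∀ j, j ≤ m → ¬ SideTouches (i.1.Ω j) y τ) → A' y τ = 0) →
          msup L m i.1.η (-(1 : ℝ)) (fun j (b : Site d × Fin d) => SideTouches (i.1.Ω j) b.1 b.2) (fun b => A' b.1 b.2)
          ≤ inp.B₀ * (bondNorm L m i.1.η (-(3 : ℝ)) i.1.Ω (fun x μ => Jcur i.1.η U₀ A' μ x)
          + wsup 1 (fun p : {p : ℕ × (Site d × Fin d) // p.1 ≤ m ∧ (p.2 ∈ i.1.Λb m p.1 ∨ (p.1 = 0 ∧ CrossB (i.1.Ω 0) p.2))} =>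
          linCovIter L U₀ (iEta i.1.η A') p.1.1 p.1.2.1 p.1.2.2))
          + Bbd * msup L m i.1.η (-(1 : ℝ)) (fun j (b : Site d × Fin d) => j = 0 ∧ SideTouches (i.1.Ω 0) b.1 b.2 ∧ ¬ BondTouches (i.1.Ω 0) b.1 b.2)
              (fun b => A' b.1 b.2) ∧
          msup L m i.1.η (-(2 : ℝ)) (fun j (t : Fin d × Fin d × Site d) => SideTouches (i.1.Ω j) t.2.2 t.2.1)
          (fun t => covDerivFwd i.1.η U₀ t.1 (fun z => A' z t.2.1) t.2.2)
          ≤ inp.B₀ * (bondNorm L m i.1.η (-(3 : ℝ)) i.1.Ω (fun x μ => Jcur i.1.η U₀ A' μ x)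
          + wsup 1 (fun p : {p : ℕ × (Site d × Fin d) // p.1 ≤ m ∧ (p.2 ∈ i.1.Λb m p.1 ∨ (p.1 = 0 ∧ CrossB (i.1.Ω 0) p.2))} =>
          linCovIter L U₀ (iEta i.1.η A') p.1.1 p.1.2.1 p.1.2.2))
          + Bbd * msup L m i.1.η (-(1 : ℝ)) (fun j (b : Site d × Fin d) => j = 0 ∧ SideTouches (i.1.Ω 0) b.1 b.2 ∧ ¬ BondTouches (i.1.Ω 0) b.1 b.2)
              (fun b => A' b.1 b.2)))) :
    ∃ c₁ : ℝ, 0 < c₁ ∧ ∀ {ι : Type} (f : ι → ZdIdx d L),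
      (∀ (jf : ι) (c : CubeB8 d L (f jf).k (f jf).Ω),
      (∀ α₀ α₂ : ℝ, 0 < α₀ → α₀ ≤ cB9 → 0 < α₂ → α₂ ≤ cB9 →
      ∀ (U₀ W : Site d → Fin d → 𝔸ˣ), (∀ x κ, U₀ x κ ∈ unitaryUnits 𝔸) → (∀ x κ, W x κ ∈ unitaryUnits 𝔸) →
      InAk L c.k (f jf).η α₀ (cubeFam false L c.a c.M c.ρ c.k) U₀ → InAk L c.k (f jf).η α₀ (cubeFam false L c.a c.M c.ρ c.k) (mulCfg W U₀) → IsLandau138W L c.k (f jf).η ((cubeFam false L c.a c.M c.ρ c.k) 0) (cubeLamS L c.a c.M c.ρ c.k c.k) U₀ W →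
      ∀ A' : Site d → Fin d → 𝔸, (∀ y τ, IsSelfAdjoint (A' y τ)) →
      (∀ j, j ≤ c.k → ∀ (y : Site d) (τ : Fin d), SideTouches ((cubeFam false L c.a c.M c.ρ c.k) j) y τ →
      W y τ = cfgExp (f jf).η A' y τ ∧ ‖A' y τ‖ ≤ α₂ * ((L : ℝ) ^ j * (f jf).η)⁻¹) →
      (∀ (y : Site d) (τ : Fin d), (∀ j, j ≤ c.k → ¬ SideTouches ((cubeFam false L c.a c.M c.ρ c.k) j) y τ) → A' y τ = 0) →
      msup L c.k (f jf).η (-(1 : ℝ)) (fun j (b : Site d × Fin d) => SideTouches ((cubeFam false L c.a c.M c.ρ c.k) j) b.1 b.2) (fun b => A' b.1 b.2)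
      ≤ inp.B₀ * (bondNorm L c.k (f jf).η (-(3 : ℝ)) (cubeFam false L c.a c.M c.ρ c.k) (fun x μ => Jcur (f jf).η U₀ A' μ x)
      + wsup 1 (fun p : {p : ℕ × (Site d × Fin d) // p.1 ≤ c.k ∧ (p.2 ∈ cubeLamB L c.a c.M c.ρ c.k c.k p.1 ∨ (p.1 = 0 ∧ CrossB ((cubeFam false L c.a c.M c.ρ c.k) 0) p.2))} =>
      linCovIter L U₀ (iEta (f jf).η A') p.1.1 p.1.2.1 p.1.2.2)) + Bbd * msup L c.k (f jf).η (-(1 : ℝ))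
      (fun j (b : Site d × Fin d) => j = 0 ∧ SideTouches ((cubeFam false L c.a c.M c.ρ c.k) 0) b.1 b.2 ∧ ¬ BondTouches ((cubeFam false L c.a c.M c.ρ c.k) 0) b.1 b.2)
      (fun b => A' b.1 b.2) ∧
      msup L c.k (f jf).η (-(2 : ℝ)) (fun j (t : Fin d × Fin d × Site d) => SideTouches ((cubeFam false L c.a c.M c.ρ c.k) j) t.2.2 t.2.1)
      (fun t => covDerivFwd (f jf).η U₀ t.1 (fun z => A' z t.2.1) t.2.2)
      ≤ inp.B₀ * (bondNorm L c.k (f jf).η (-(3 : ℝ)) (cubeFam false L c.a c.M c.ρ c.k) (fun x μ => Jcur (f jf).η U₀ A' μ x)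
      + wsup 1 (fun p : {p : ℕ × (Site d × Fin d) // p.1 ≤ c.k ∧ (p.2 ∈ cubeLamB L c.a c.M c.ρ c.k c.k p.1 ∨ (p.1 = 0 ∧ CrossB ((cubeFam false L c.a c.M c.ρ c.k) 0) p.2))} =>
      linCovIter L U₀ (iEta (f jf).η A') p.1.1 p.1.2.1 p.1.2.2)) + Bbd * msup L c.k (f jf).η (-(1 : ℝ))
      (fun j (b : Site d × Fin d) => j = 0 ∧ SideTouches ((cubeFam false L c.a c.M c.ρ c.k) 0) b.1 b.2 ∧ ¬ BondTouches ((cubeFam false L c.a c.M c.ρ c.k) 0) b.1 b.2)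
      (fun b => A' b.1 b.2) ∧
      bondNorm L c.k (f jf).η (-(3 : ℝ)) (cubeFam false L c.a c.M c.ρ c.k) (fun x μ => pdiv (f jf).η U₀ (plaqCovDeriv (f jf).η U₀ A') μ x)
      ≤ inp.B₀ * (bondNorm L c.k (f jf).η (-(3 : ℝ)) (cubeFam false L c.a c.M c.ρ c.k) (fun x μ => Jcur (f jf).η U₀ A' μ x)
      + wsup 1 (fun p : {p : ℕ × (Site d × Fin d) // p.1 ≤ c.k ∧ (p.2 ∈ cubeLamB L c.a c.M c.ρ c.k c.k p.1 ∨ (p.1 = 0 ∧ CrossB ((cubeFam false L c.a c.M c.ρ c.k) 0) p.2))} =>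
      linCovIter L U₀ (iEta (f jf).η A') p.1.1 p.1.2.1 p.1.2.2)) + Bbd * msup L c.k (f jf).η (-(1 : ℝ))
      (fun j (b : Site d × Fin d) => j = 0 ∧ SideTouches ((cubeFam false L c.a c.M c.ρ c.k) 0) b.1 b.2 ∧ ¬ BondTouches ((cubeFam false L c.a c.M c.ρ c.k) 0) b.1 b.2)
      (fun b => A' b.1 b.2) ∧
      bondNorm L c.k (f jf).η (-(3 : ℝ)) (cubeFam false L c.a c.M c.ρ c.k) (fun x μ => covLap (f jf).η U₀ (fun z => A' z μ) x)
      ≤ inp.B₀ * (bondNorm L c.k (f jf).η (-(3 : ℝ)) (cubeFam false L c.a c.M c.ρ c.k) (fun x μ => Jcur (f jf).η U₀ A' μ x)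
      + wsup 1 (fun p : {p : ℕ × (Site d × Fin d) // p.1 ≤ c.k ∧ (p.2 ∈ cubeLamB L c.a c.M c.ρ c.k c.k p.1 ∨ (p.1 = 0 ∧ CrossB ((cubeFam false L c.a c.M c.ρ c.k) 0) p.2))} =>
      linCovIter L U₀ (iEta (f jf).η A') p.1.1 p.1.2.1 p.1.2.2)) + Bbd * msup L c.k (f jf).η (-(1 : ℝ))
      (fun j (b : Site d × Fin d) => j = 0 ∧ SideTouches ((cubeFam false L c.a c.M c.ρ c.k) 0) b.1 b.2 ∧ ¬ BondTouches ((cubeFam false L c.a c.M c.ρ c.k) 0) b.1 b.2)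
      (fun b => A' b.1 b.2))) →
      B8.Prop6Printed d (L : ℝ) (5 * (d : ℝ) * L * inp.B₀) c₁ (fun j => zdCub 𝔸 L (f j)) := by
  obtain ⟨cₑ, hcₑ, Hₑ⟩ := thm4ExistsBody_zd3_map_bdryβ (𝔸 := 𝔸) hd2 hL (β := 0) (len := fun _ => (0 : ℝ)) inp.B₀_pos inp.B₀'_pos hB hcP hBbd hBd
    (Subtype.val : {i : ZdIdx d L // ∃ (a : Site d) (M ρ : ℕ), L ≤ ρ ∧ ρ ≤ M ∧ 11 * d < M ∧ L ≤ d * M ∧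
      i.Ω = cubeFam false L a M ρ i.k ∧ i.Λs = cubeLamS L a M ρ i.k ∧ i.Λb = cubeLamB L a M ρ i.k} → ZdIdx d L)
    (fun j => bdryLayer_cubeSubfamily hL j) SP5base SP5 SH59Dβ
  exact prop6Printed_zdCub_of_thm4Exists_b9Dβ_d4 (𝔸 := 𝔸) hd2 hL inp hC₂ hcB9 hBbd hBd 0 (fun _ => (0 : ℝ)) hcₑ Hₑ

#print axioms prop6Printed_zdCub_bdryβ₃_d4

/-! ## §2 The binder-agnostic consumer without the uniqueness socket -/

/-- ★★ **PROPOSITION 6 ON THE CUBE MEMBERS FROM AN ALL-LEVELS FOUR-LINE β SOCKET FAMILY ON THE CUBE SUB-FAMILY AND PROPOSITION 5's TWO EXISTENCE SOCKETS —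
BINDER-AGNOSTIC, WINDOW-FREE, `H4`-FREE, `SockP5u`-FREE.**  p547598's `prop6Printed_zdCub_of_sockD4βFamily` minus `SP5u`∕`cu`: whatever supplies, for SOME
`B₀`, `B_∂ ≥ 0`, `cP₉ > 0`, the β collar socket `SockB9P3D4β L B₀ B_∂ cP₉` at EVERY member of the cube sub-family of (1.131) and EVERY truncation `m ≤ k` (today:
dag-n06-b's `sockB9P3D4β_allLevels_of_thm33_on`) gives, with `SockP5base`∕`SockP5` at the ENLARGED constant `B₀ˢ = max{max{1, B₀}, 4B_∂∕(dL − 1)}` (absorption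
window `4B_∂ ≤ (dL − 1)B₀ˢ` identically), a threshold `c₁ > 0` with `B8.Prop6Printed d L (5dL·B₀ˢ) c₁` on `zdCub ∘ f` for every `f`.  Proof: p547598 §4's, into §1.
[cite: Balaban1985RegularSpaces, Prop. 6 p.99, Prop. 3 p.87, Thm 4 p.88, Prop. 5 (1.107)–(1.108) p.94, (1.58)–(1.62) pp.86–87, (1.31) p.82] -/
theorem prop6Printed_zdCub_of_sockD4βFamily₃ (hd2 : 2 ≤ d) {L : ℕ} (hL : 2 ≤ L) {B₀ Bbd cP₉ B₀' C₂ cP : ℝ} (hBbd : 0 ≤ Bbd) (hcP₉ : 0 < cP₉) (hB₀' : 0 < B₀') (hC₂ : 2097152 * ((d : ℝ) + 1) ^ 2 ≤ C₂) (hcP : 0 < cP)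
    (hall : ∀ (j : {i : ZdIdx d L // ∃ (a : Site d) (M ρ : ℕ), L ≤ ρ ∧ ρ ≤ M ∧ 11 * d < M ∧ L ≤ d * M ∧
          i.Ω = cubeFam false L a M ρ i.k ∧ i.Λs = cubeLamS L a M ρ i.k ∧ i.Λb = cubeLamB L a M ρ i.k}) (m : ℕ), m ≤ j.1.k →
      SockB9P3D4β (𝔸 := 𝔸) L B₀ Bbd cP₉ j.1.η m j.1.Ω j.1.Λs j.1.Λb)
    (SP5base : ∀ i : {i : ZdIdx d L // ∃ (a : Site d) (M ρ : ℕ), L ≤ ρ ∧ ρ ≤ M ∧ 11 * d < M ∧ L ≤ d * M ∧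
          i.Ω = cubeFam false L a M ρ i.k ∧ i.Λs = cubeLamS L a M ρ i.k ∧ i.Λb = cubeLamB L a M ρ i.k},
      SockP5base (𝔸 := 𝔸) L (max (max 1 B₀) (4 * Bbd / ((d : ℝ) * L - 1))) B₀' cP i.1.η i.1.k i.1.Ω i.1.Λs)
    (SP5 : ∀ i : {i : ZdIdx d L // ∃ (a : Site d) (M ρ : ℕ), L ≤ ρ ∧ ρ ≤ M ∧ 11 * d < M ∧ L ≤ d * M ∧
          i.Ω = cubeFam false L a M ρ i.k ∧ i.Λs = cubeLamS L a M ρ i.k ∧ i.Λb = cubeLamB L a M ρ i.k},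
      SockP5 (𝔸 := 𝔸) L (max (max 1 B₀) (4 * Bbd / ((d : ℝ) * L - 1))) B₀' cP i.1.η i.1.k i.1.Ω i.1.Λs) :
    ∃ c₁ : ℝ, 0 < c₁ ∧ ∀ {ι' : Type} (f : ι' → ZdIdx d L),
      B8.Prop6Printed d (L : ℝ) (5 * (d : ℝ) * L * (max (max 1 B₀) (4 * Bbd / ((d : ℝ) * L - 1)))) c₁ (fun j => zdCub 𝔸 L (f j)) := by
  have hL1 : 1 ≤ L := le_trans (by norm_num) hL
  have hd1 : 1 ≤ d := le_trans (by norm_num) hd2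
  have hLr : (2 : ℝ) ≤ L := by exact_mod_cast hL
  have hdr : (2 : ℝ) ≤ d := by exact_mod_cast hd2
  have hdL : (0 : ℝ) < (d : ℝ) * L - 1 := by nlinarith [hLr, hdr]
  -- the ENLARGED constant
  set B₀S : ℝ := max (max 1 B₀) (4 * Bbd / ((d : ℝ) * L - 1)) with hB₀S_def
  have hB₀S1 : 1 ≤ B₀S := (le_max_left 1 B₀).trans (le_max_left _ _)
  have hB₀S : 0 < B₀S := lt_of_lt_of_le one_pos hB₀S1
  have hDS : B₀ ≤ B₀S := (le_max_right 1 B₀).trans (le_max_left _ _)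
  obtain ⟨inp, hinp, hinp'⟩ : ∃ inp : B8.B9Inputs, inp.B₀ = B₀S ∧ inp.B₀' = B₀' := ⟨⟨B₀S, B₀', hB₀S, hB₀'⟩, rfl, rfl⟩
  have hB : 2 ≤ 5 * (d : ℝ) * L * inp.B₀ := by
    rw [hinp]
    have h1 : (2 : ℝ) ≤ 5 * (d : ℝ) * L := by nlinarith [hLr, hdr]
    nlinarith [h1, hB₀S1]
  -- the absorption window holds IDENTICALLY at the enlarged constant
  have hBd : 4 * Bbd ≤ ((d : ℝ) * L - 1) * inp.B₀ := by
    rw [hinp]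
    have h1 : 4 * Bbd / ((d : ℝ) * L - 1) ≤ B₀S := le_max_right _ _
    have h2 : 4 * Bbd = ((d : ℝ) * L - 1) * (4 * Bbd / ((d : ℝ) * L - 1)) := by field_simp
    rw [h2]
    exact mul_le_mul_of_nonneg_left h1 hdL.le
  -- the socket family, moved to the enlarged constant
  have hallS : ∀ (j : {i : ZdIdx d L // ∃ (a : Site d) (M ρ : ℕ), L ≤ ρ ∧ ρ ≤ M ∧ 11 * d < M ∧ L ≤ d * M ∧
      i.Ω = cubeFam false L a M ρ i.k ∧ i.Λs = cubeLamS L a M ρ i.k ∧ i.Λb = cubeLamB L a M ρ i.k}) (m : ℕ), m ≤ j.1.k →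
      SockB9P3D4β (𝔸 := 𝔸) L B₀S Bbd cP₉ j.1.η m j.1.Ω j.1.Λs j.1.Λb :=
    fun j m hm => sockB9P3D4β_mono_B₀ hDS (j.1.hη).le (hall j m hm)
  -- the merged threshold
  set c59 : ℝ := min cP₉ (cP₉ / (2 * (L * (5 * (d : ℝ) * L * B₀S)) + 8 * (8 * B₀' * (5 * (d : ℝ) * L * B₀S)))) with hc59_def
  have hK₀ : 0 < 2 * (L * (5 * (d : ℝ) * L * B₀S)) + 8 * (8 * B₀' * (5 * (d : ℝ) * L * B₀S)) := by
    have h1 : 0 < 2 * (L * (5 * (d : ℝ) * L * B₀S)) := by positivity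
    have h2 : 0 ≤ 8 * (8 * B₀' * (5 * (d : ℝ) * L * B₀S)) := by positivity
    linarith
  have hc59 : 0 < c59 := lt_min hcP₉ (div_pos hcP₉ hK₀)
  set cPs : ℝ := min cP c59 with hcPs_def
  have hcPs : 0 < cPs := lt_min hcP hc59
  have hcPsP : cPs ≤ cP := min_le_left _ _
  have hcPs9 : cPs ≤ c59 := min_le_right _ _
  obtain ⟨c₁, hc₁, G⟩ := prop6Printed_zdCub_bdryβ₃_d4 (𝔸 := 𝔸) hd2 hL inp (C₂ := C₂) (cB9 := cP₉) (cP := cPs)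
    (Bbd := Bbd) hB hC₂ hcP₉ hcPs hBbd hBd
    (fun i => by rw [hinp, hinp']; exact sockP5base_anti hcPsP (SP5base i))
    (fun i => by rw [hinp, hinp']; exact sockP5_anti hcPsP (SP5 i))
    (fun i α₀ α₁ hα₀ hα₁ hle => by
      rw [hinp, hinp']
      exact sockH59Dβ_of_allLevelsD4β hd1 hL1 hB₀S hB₀'.le hcP₉ (fun m hm => hallS i m hm) α₀ α₁ hα₀ hα₁ (hle.trans hcPs9))
  refine ⟨c₁, hc₁, fun f => ?_⟩
  have hP := G f (fun jf c => by
    rw [hinp]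
    exact hallS ⟨⟨(f jf).η, (f jf).hη, c.k, c.one_le_k, cubeFam false L c.a c.M c.ρ c.k, hΩ_cubeFam hL1 c.a c.M c.L_le_ρ c.k,
      cubeLamS L c.a c.M c.ρ c.k, cubeLamB L c.a c.M c.ρ c.k, hbox_cubeLamB L c.a c.M c.ρ c.k, hclass_cubeLamB L c.a c.M c.ρ c.k,
      htower_cubeLam hL1 c.a c.M c.ρ c.k, hpart_cubeLam hL1 c.a c.M c.ρ c.k⟩,
      ⟨c.a, c.M, c.ρ, c.L_le_ρ, c.ρ_le_M, c.big, c.L_le_dM, rfl, rfl, rfl⟩⟩ c.k le_rfl)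
  rw [hinp] at hP
  exact hP

#print axioms prop6Printed_zdCub_of_sockD4βFamily₃

/-! ## §3 The junction knit from Theorem 3.3 by name, without the uniqueness socket, in dag-n05-d's plug shape -/

/-- ★★★ **PROPOSITION 6 ON THE CUBE MEMBERS FROM [4] THEOREM 3.3 BY NAME, EDITION β, WITHOUT PROPOSITION 5's UNIQUENESS SOCKET — the junction knit of
record, existence road.**  `B9.Thm33Printed` + dag-n06-b's six member-local [4]-letter binders on the cube sub-family of (1.131) in edition β (`DictAt`, `Prop6At`,
`InvAt`, `CurvAt`, `LandauAt`, ★ `AvgAtβ`) give, by dag-n06-b's `sockB9P3D4β_allLevels_of_thm33_on` (p541339), an all-levels `SockB9P3D4β` family on the cube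
sub-family with constants `(B₀, cP₉)` from Theorem 3.3's block alone; `prop6Printed_zdCub_of_sockD4βFamily₃` turns it, with Proposition 5's TWO EXISTENCE
sockets (∃ base ∕ ∃ step) at the enlarged constant `B₀ˢ ≥ 1` — quantified AFTER `B₀ˢ` together with their parameters `B₀′, cP` (dag-n05-d's plug shape) —
into `B8.Prop6Printed d L (5dL·B₀ˢ) c₁` on `zdCub ∘ f` for every cube index `f`.  = `B8Prop6CubeMemberOfThm33Beta.prop6Printed_zdCub_of_thm33β_uniform`
(p563537) MINUS the `SockP5u` hypothesis and the radius `cu` (print p. 99: Proposition 6 uses Theorem 4's existence half only; the uniqueness socket has no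
provider at cube members — dag-n05-d g9).  A6 LINE (director-ym №189 (3)), unchanged: the binder set behind `hdict`…`havg` is INHABITED at every cube
member at truncation `m = 0` by dag-n06-b's `B9SupplySockB9P3ZdBeta.Witness.binders_inhabited_cube_zero` (trivial massive regime; honest label theirs);
NOT witnessed: the binders at `m ≥ 1` ([4] Sect. A + Thm 3.11), `B9.Thm33Printed` (N06), Proposition 5's two existence sockets (N05's Prop.-5 lane); no
joint-satisfiability claim beyond that.
[cite: Balaban1985RegularSpaces, Prop. 6 p.99, Prop. 3 p.87, Thm 4 p.88, Prop. 5 (1.107)–(1.108) p.94, (1.56)–(1.62) pp.86–87, (1.31) p.82; Balaban1985BackgroundPropagators, Thm 3.3 p.399, (3.16) p.393] -/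
theorem prop6Printed_zdCub_of_thm33β₃ (hd2 : 2 ≤ d) {L : ℕ} (hL : 2 ≤ L)
    {I : Type} (geo : I → B9.Geometry) (bg : I → B9.Backgrounds) (GA : ∀ i, B9.KernelFamily (geo i) (bg i))
    (mem : ℝ → ZdIdx d L → ℕ → I)
    (ιCfg : ∀ (M : ℝ) (i : ZdIdx d L) (m : ℕ) (U₀ : Site d → Fin d → 𝔸ˣ), (∀ x κ, U₀ x κ ∈ unitaryUnits 𝔸) → (bg (mem M i m)).Cfg)
    (ιLoc : ∀ (M : ℝ) (i : ZdIdx d L) (m : ℕ), (Site d → Fin d → 𝔸) → (geo (mem M i m)).Loc)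
    (ops : ℝ → ZdIdx d L → ℕ → OpsZd d 𝔸) {c35 c₆ K₆ M₃ a₃ c69 q : ℝ}
    {Gp : ∀ i, B9.KernelFamily (geo i) (bg i)} (h33 : B9.Thm33Printed c35 geo bg Gp GA)
    (hdict : ∀ (M : ℝ) (j : {i : ZdIdx d L // ∃ (a : Site d) (M ρ : ℕ), L ≤ ρ ∧ ρ ≤ M ∧ 11 * d < M ∧ L ≤ d * M ∧
          i.Ω = cubeFam false L a M ρ i.k ∧ i.Λs = cubeLamS L a M ρ i.k ∧ i.Λb = cubeLamB L a M ρ i.k}) (m : ℕ),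
      DictAt geo bg GA L mem ιCfg ιLoc ops M j.1 m)
    (hP6 : ∀ (M : ℝ) (j : {i : ZdIdx d L // ∃ (a : Site d) (M ρ : ℕ), L ≤ ρ ∧ ρ ≤ M ∧ 11 * d < M ∧ L ≤ d * M ∧
          i.Ω = cubeFam false L a M ρ i.k ∧ i.Λs = cubeLamS L a M ρ i.k ∧ i.Λb = cubeLamB L a M ρ i.k}) (m : ℕ),
      M₃ ≤ M → Prop6At bg L mem ιCfg c35 c₆ K₆ M j.1 m)
    (hinv : ∀ (M : ℝ) (j : {i : ZdIdx d L // ∃ (a : Site d) (M ρ : ℕ), L ≤ ρ ∧ ρ ≤ M ∧ 11 * d < M ∧ L ≤ d * M ∧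
          i.Ω = cubeFam false L a M ρ i.k ∧ i.Λs = cubeLamS L a M ρ i.k ∧ i.Λb = cubeLamB L a M ρ i.k}) (m : ℕ),
      M₃ ≤ M → InvAt bg L mem ιCfg ops c35 a₃ M j.1 m)
    (hcurv : ∀ (M : ℝ) (j : {i : ZdIdx d L // ∃ (a : Site d) (M ρ : ℕ), L ≤ ρ ∧ ρ ≤ M ∧ 11 * d < M ∧ L ≤ d * M ∧
          i.Ω = cubeFam false L a M ρ i.k ∧ i.Λs = cubeLamS L a M ρ i.k ∧ i.Λb = cubeLamB L a M ρ i.k}) (m : ℕ),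
      M₃ ≤ M → CurvAt bg L mem ιCfg ops c35 a₃ c69 M j.1 m)
    (hlan : ∀ (M : ℝ) (j : {i : ZdIdx d L // ∃ (a : Site d) (M ρ : ℕ), L ≤ ρ ∧ ρ ≤ M ∧ 11 * d < M ∧ L ≤ d * M ∧
          i.Ω = cubeFam false L a M ρ i.k ∧ i.Λs = cubeLamS L a M ρ i.k ∧ i.Λb = cubeLamB L a M ρ i.k}) (m : ℕ),
      M₃ ≤ M → LandauAt bg L mem ιCfg ops c35 a₃ M j.1 m)
    (havg : ∀ (M : ℝ) (j : {i : ZdIdx d L // ∃ (a : Site d) (M ρ : ℕ), L ≤ ρ ∧ ρ ≤ M ∧ 11 * d < M ∧ L ≤ d * M ∧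
          i.Ω = cubeFam false L a M ρ i.k ∧ i.Λs = cubeLamS L a M ρ i.k ∧ i.Λb = cubeLamB L a M ρ i.k}) (m : ℕ),
      AvgAtβ L ops q M j.1 m)
    (hc₆ : 0 < c₆) (hK₆ : 0 < K₆) (ha₃ : 0 < a₃) (hc69 : 0 ≤ c69) (hq : 0 ≤ q) :
    ∃ B₀S : ℝ, 1 ≤ B₀S ∧ ∀ {B₀' cP : ℝ}, 0 < B₀' → 0 < cP →
      ((∀ i : {i : ZdIdx d L // ∃ (a : Site d) (M ρ : ℕ), L ≤ ρ ∧ ρ ≤ M ∧ 11 * d < M ∧ L ≤ d * M ∧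
          i.Ω = cubeFam false L a M ρ i.k ∧ i.Λs = cubeLamS L a M ρ i.k ∧ i.Λb = cubeLamB L a M ρ i.k},
          SockP5base (𝔸 := 𝔸) L B₀S B₀' cP i.1.η i.1.k i.1.Ω i.1.Λs) →
       (∀ i : {i : ZdIdx d L // ∃ (a : Site d) (M ρ : ℕ), L ≤ ρ ∧ ρ ≤ M ∧ 11 * d < M ∧ L ≤ d * M ∧
          i.Ω = cubeFam false L a M ρ i.k ∧ i.Λs = cubeLamS L a M ρ i.k ∧ i.Λb = cubeLamB L a M ρ i.k},
          SockP5 (𝔸 := 𝔸) L B₀S B₀' cP i.1.η i.1.k i.1.Ω i.1.Λs) →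
       ∃ c₁ : ℝ, 0 < c₁ ∧ ∀ {ι' : Type} (f : ι' → ZdIdx d L),
         B8.Prop6Printed d (L : ℝ) (5 * (d : ℝ) * L * B₀S) c₁ (fun j => zdCub 𝔸 L (f j))) := by
  have hL1 : 1 ≤ L := le_trans (by norm_num) hL
  -- the cube members have `Margin2` (ρ ≥ L ≥ 2)
  have hMJ : ∀ i : {i : ZdIdx d L // ∃ (a : Site d) (M ρ : ℕ), L ≤ ρ ∧ ρ ≤ M ∧ 11 * d < M ∧ L ≤ d * M ∧
      i.Ω = cubeFam false L a M ρ i.k ∧ i.Λs = cubeLamS L a M ρ i.k ∧ i.Λb = cubeLamB L a M ρ i.k}, Margin2 i.1.Ω := by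
    rintro ⟨i, a, M, ρ, hρ, -, -, -, hΩ, -, -⟩
    dsimp only
    rw [hΩ]
    exact margin2_cubeFam L a M (hL.trans hρ) i.k
  -- ONE call of dag-n06-b's β junction over the cube sub-family index: `B₀, cP9` depend on Theorem 3.3's block only
  obtain ⟨B₀, cP9, hB₀, hcP9, hall⟩ := sockB9P3D4β_allLevels_of_thm33_on geo bg GA L mem ιCfg ιLoc ops hd2 hL1 h33
    (Subtype.val : {i : ZdIdx d L // ∃ (a : Site d) (M ρ : ℕ), L ≤ ρ ∧ ρ ≤ M ∧ 11 * d < M ∧ L ≤ d * M ∧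
      i.Ω = cubeFam false L a M ρ i.k ∧ i.Λs = cubeLamS L a M ρ i.k ∧ i.Λb = cubeLamB L a M ρ i.k} → ZdIdx d L) hMJ
    hdict hP6 hinv hcurv hlan havg hc₆ hK₆ ha₃ hc69 hq
  have hBbd : 0 ≤ (20 * (d : ℝ) + 2) * max 1 (2 * B₀ * max 1 q) := by positivity
  have hC₂ : 2097152 * ((d : ℝ) + 1) ^ 2 ≤ 2097152 * ((d : ℝ) + 1) ^ 2 := le_rfl
  refine ⟨max (max 1 (max 1 (2 * B₀ * max 1 q))) (4 * ((20 * (d : ℝ) + 2) * max 1 (2 * B₀ * max 1 q)) / ((d : ℝ) * L - 1)),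
    (le_max_left _ _).trans (le_max_left _ _), fun hB₀' hcP SP5base SP5 => ?_⟩
  exact prop6Printed_zdCub_of_sockD4βFamily₃ (𝔸 := 𝔸) hd2 hL hBbd hcP9 hB₀' hC₂ hcP hall SP5base SP5

#print axioms prop6Printed_zdCub_of_thm33β₃

/-- ★★ **THE SAME KNIT WITH ITS β SOCKET FAMILY EXPORTED** (dag-n05-d's CONSUMER-NOTE-2, bus 2026-08-27 20:04Z — «servability of `hSP5C`»): besides
`B₀ˢ ≥ 1`, the theorem hands out dag-n06-b's all-levels four-line β socket family `hall : SockB9P3D4β L B₀ᴰ B_∂ cP₉` on the cube sub-family (constants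
from Theorem 3.3's block: `B₀ᴰ = max{1, 2B₀·max{1,q}} > 0`, `B_∂ = (20d + 2)·max{1, 2B₀·max{1,q}} ≥ 0`, `cP₉ > 0`) together with `B₀ᴰ ≤ B₀ˢ` and the
absorption window `4B_∂ ≤ (dL − 1)B₀ˢ`, so that a letters-based supplier of Proposition 5's two existence sockets at the cube members (which needs a
(1.59)-family at a constant `≤ B₀ˢ`, `B8LeafKnitZd3CubBdryBeta.sockB9P3D4β_mono_B₀`) can be fed the SAME family; then, for all `B₀′, cP > 0` and the two
sockets at `(B₀ˢ, B₀′, cP)`, `∃ c₁ > 0, ∀ f, B8.Prop6Printed d L (5dL·B₀ˢ) c₁ (zdCub ∘ f)`.  No `SockP5u`.  A6 line as in §3.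
[cite: Balaban1985RegularSpaces, Prop. 6 p.99, Prop. 3 p.87, Thm 4 p.88, Prop. 5 (1.107)–(1.108) p.94, (1.59) p.86, (1.31) p.82; Balaban1985BackgroundPropagators, Thm 3.3 p.399, (3.16) p.393] -/
theorem prop6Printed_zdCub_of_thm33β₃_hall (hd2 : 2 ≤ d) {L : ℕ} (hL : 2 ≤ L)
    {I : Type} (geo : I → B9.Geometry) (bg : I → B9.Backgrounds) (GA : ∀ i, B9.KernelFamily (geo i) (bg i))
    (mem : ℝ → ZdIdx d L → ℕ → I)
    (ιCfg : ∀ (M : ℝ) (i : ZdIdx d L) (m : ℕ) (U₀ : Site d → Fin d → 𝔸ˣ), (∀ x κ, U₀ x κ ∈ unitaryUnits 𝔸) → (bg (mem M i m)).Cfg)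
    (ιLoc : ∀ (M : ℝ) (i : ZdIdx d L) (m : ℕ), (Site d → Fin d → 𝔸) → (geo (mem M i m)).Loc)
    (ops : ℝ → ZdIdx d L → ℕ → OpsZd d 𝔸) {c35 c₆ K₆ M₃ a₃ c69 q : ℝ}
    {Gp : ∀ i, B9.KernelFamily (geo i) (bg i)} (h33 : B9.Thm33Printed c35 geo bg Gp GA)
    (hdict : ∀ (M : ℝ) (j : {i : ZdIdx d L // ∃ (a : Site d) (M ρ : ℕ), L ≤ ρ ∧ ρ ≤ M ∧ 11 * d < M ∧ L ≤ d * M ∧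
          i.Ω = cubeFam false L a M ρ i.k ∧ i.Λs = cubeLamS L a M ρ i.k ∧ i.Λb = cubeLamB L a M ρ i.k}) (m : ℕ),
      DictAt geo bg GA L mem ιCfg ιLoc ops M j.1 m)
    (hP6 : ∀ (M : ℝ) (j : {i : ZdIdx d L // ∃ (a : Site d) (M ρ : ℕ), L ≤ ρ ∧ ρ ≤ M ∧ 11 * d < M ∧ L ≤ d * M ∧
          i.Ω = cubeFam false L a M ρ i.k ∧ i.Λs = cubeLamS L a M ρ i.k ∧ i.Λb = cubeLamB L a M ρ i.k}) (m : ℕ),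
      M₃ ≤ M → Prop6At bg L mem ιCfg c35 c₆ K₆ M j.1 m)
    (hinv : ∀ (M : ℝ) (j : {i : ZdIdx d L // ∃ (a : Site d) (M ρ : ℕ), L ≤ ρ ∧ ρ ≤ M ∧ 11 * d < M ∧ L ≤ d * M ∧
          i.Ω = cubeFam false L a M ρ i.k ∧ i.Λs = cubeLamS L a M ρ i.k ∧ i.Λb = cubeLamB L a M ρ i.k}) (m : ℕ),
      M₃ ≤ M → InvAt bg L mem ιCfg ops c35 a₃ M j.1 m)
    (hcurv : ∀ (M : ℝ) (j : {i : ZdIdx d L // ∃ (a : Site d) (M ρ : ℕ), L ≤ ρ ∧ ρ ≤ M ∧ 11 * d < M ∧ L ≤ d * M ∧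
          i.Ω = cubeFam false L a M ρ i.k ∧ i.Λs = cubeLamS L a M ρ i.k ∧ i.Λb = cubeLamB L a M ρ i.k}) (m : ℕ),
      M₃ ≤ M → CurvAt bg L mem ιCfg ops c35 a₃ c69 M j.1 m)
    (hlan : ∀ (M : ℝ) (j : {i : ZdIdx d L // ∃ (a : Site d) (M ρ : ℕ), L ≤ ρ ∧ ρ ≤ M ∧ 11 * d < M ∧ L ≤ d * M ∧
          i.Ω = cubeFam false L a M ρ i.k ∧ i.Λs = cubeLamS L a M ρ i.k ∧ i.Λb = cubeLamB L a M ρ i.k}) (m : ℕ),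
      M₃ ≤ M → LandauAt bg L mem ιCfg ops c35 a₃ M j.1 m)
    (havg : ∀ (M : ℝ) (j : {i : ZdIdx d L // ∃ (a : Site d) (M ρ : ℕ), L ≤ ρ ∧ ρ ≤ M ∧ 11 * d < M ∧ L ≤ d * M ∧
          i.Ω = cubeFam false L a M ρ i.k ∧ i.Λs = cubeLamS L a M ρ i.k ∧ i.Λb = cubeLamB L a M ρ i.k}) (m : ℕ),
      AvgAtβ L ops q M j.1 m)
    (hc₆ : 0 < c₆) (hK₆ : 0 < K₆) (ha₃ : 0 < a₃) (hc69 : 0 ≤ c69) (hq : 0 ≤ q) :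
    ∃ B₀D Bbd cP₉ B₀S : ℝ, 0 < B₀D ∧ 0 ≤ Bbd ∧ 0 < cP₉ ∧ 1 ≤ B₀S ∧ B₀D ≤ B₀S ∧ 4 * Bbd ≤ ((d : ℝ) * L - 1) * B₀S ∧
      -- THE EXPORTED all-levels four-line β socket family on the cube sub-family (dag-n06-b's, from Theorem 3.3's block)
      (∀ (j : {i : ZdIdx d L // ∃ (a : Site d) (M ρ : ℕ), L ≤ ρ ∧ ρ ≤ M ∧ 11 * d < M ∧ L ≤ d * M ∧
          i.Ω = cubeFam false L a M ρ i.k ∧ i.Λs = cubeLamS L a M ρ i.k ∧ i.Λb = cubeLamB L a M ρ i.k}) (m : ℕ), m ≤ j.1.k →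
        SockB9P3D4β (𝔸 := 𝔸) L B₀D Bbd cP₉ j.1.η m j.1.Ω j.1.Λs j.1.Λb) ∧
      ∀ {B₀' cP : ℝ}, 0 < B₀' → 0 < cP →
      ((∀ i : {i : ZdIdx d L // ∃ (a : Site d) (M ρ : ℕ), L ≤ ρ ∧ ρ ≤ M ∧ 11 * d < M ∧ L ≤ d * M ∧
          i.Ω = cubeFam false L a M ρ i.k ∧ i.Λs = cubeLamS L a M ρ i.k ∧ i.Λb = cubeLamB L a M ρ i.k},
          SockP5base (𝔸 := 𝔸) L B₀S B₀' cP i.1.η i.1.k i.1.Ω i.1.Λs) →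
       (∀ i : {i : ZdIdx d L // ∃ (a : Site d) (M ρ : ℕ), L ≤ ρ ∧ ρ ≤ M ∧ 11 * d < M ∧ L ≤ d * M ∧
          i.Ω = cubeFam false L a M ρ i.k ∧ i.Λs = cubeLamS L a M ρ i.k ∧ i.Λb = cubeLamB L a M ρ i.k},
          SockP5 (𝔸 := 𝔸) L B₀S B₀' cP i.1.η i.1.k i.1.Ω i.1.Λs) →
       ∃ c₁ : ℝ, 0 < c₁ ∧ ∀ {ι' : Type} (f : ι' → ZdIdx d L),
         B8.Prop6Printed d (L : ℝ) (5 * (d : ℝ) * L * B₀S) c₁ (fun j => zdCub 𝔸 L (f j))) := by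
  have hL1 : 1 ≤ L := le_trans (by norm_num) hL
  have hLr : (2 : ℝ) ≤ L := by exact_mod_cast hL
  have hdr : (2 : ℝ) ≤ d := by exact_mod_cast hd2
  have hdL : (0 : ℝ) < (d : ℝ) * L - 1 := by nlinarith [hLr, hdr]
  -- the cube members have `Margin2` (ρ ≥ L ≥ 2)
  have hMJ : ∀ i : {i : ZdIdx d L // ∃ (a : Site d) (M ρ : ℕ), L ≤ ρ ∧ ρ ≤ M ∧ 11 * d < M ∧ L ≤ d * M ∧
          i.Ω = cubeFam false L a M ρ i.k ∧ i.Λs = cubeLamS L a M ρ i.k ∧ i.Λb = cubeLamB L a M ρ i.k}, Margin2 i.1.Ω := by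
    rintro ⟨i, a, M, ρ, hρ, -, -, -, hΩ, -, -⟩
    dsimp only
    rw [hΩ]
    exact margin2_cubeFam L a M (hL.trans hρ) i.k
  -- ONE call of dag-n06-b's β junction over the cube sub-family index
  obtain ⟨B₀, cP9, hB₀, hcP9, hall⟩ := sockB9P3D4β_allLevels_of_thm33_on geo bg GA L mem ιCfg ιLoc ops hd2 hL1 h33
    (Subtype.val : {i : ZdIdx d L // ∃ (a : Site d) (M ρ : ℕ), L ≤ ρ ∧ ρ ≤ M ∧ 11 * d < M ∧ L ≤ d * M ∧
          i.Ω = cubeFam false L a M ρ i.k ∧ i.Λs = cubeLamS L a M ρ i.k ∧ i.Λb = cubeLamB L a M ρ i.k} → ZdIdx d L) hMJ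
    hdict hP6 hinv hcurv hlan havg hc₆ hK₆ ha₃ hc69 hq
  have hBbd : 0 ≤ (20 * (d : ℝ) + 2) * max 1 (2 * B₀ * max 1 q) := by positivity
  have hC₂ : 2097152 * ((d : ℝ) + 1) ^ 2 ≤ 2097152 * ((d : ℝ) + 1) ^ 2 := le_rfl
  refine ⟨max 1 (2 * B₀ * max 1 q), (20 * (d : ℝ) + 2) * max 1 (2 * B₀ * max 1 q), cP9,
    max (max 1 (max 1 (2 * B₀ * max 1 q))) (4 * ((20 * (d : ℝ) + 2) * max 1 (2 * B₀ * max 1 q)) / ((d : ℝ) * L - 1)),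
    lt_of_lt_of_le one_pos (le_max_left _ _), hBbd, hcP9, (le_max_left _ _).trans (le_max_left _ _),
    (le_max_right _ _).trans (le_max_left _ _), ?_, hall, fun hB₀' hcP SP5base SP5 => ?_⟩
  · have h1 : 4 * ((20 * (d : ℝ) + 2) * max 1 (2 * B₀ * max 1 q)) / ((d : ℝ) * L - 1) ≤
        max (max 1 (max 1 (2 * B₀ * max 1 q))) (4 * ((20 * (d : ℝ) + 2) * max 1 (2 * B₀ * max 1 q)) / ((d : ℝ) * L - 1)) :=
      le_max_right _ _
    calc 4 * ((20 * (d : ℝ) + 2) * max 1 (2 * B₀ * max 1 q))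
        = ((d : ℝ) * L - 1) * (4 * ((20 * (d : ℝ) + 2) * max 1 (2 * B₀ * max 1 q)) / ((d : ℝ) * L - 1)) := by field_simp
      _ ≤ ((d : ℝ) * L - 1) *
          max (max 1 (max 1 (2 * B₀ * max 1 q))) (4 * ((20 * (d : ℝ) + 2) * max 1 (2 * B₀ * max 1 q)) / ((d : ℝ) * L - 1)) :=
        mul_le_mul_of_nonneg_left h1 hdL.le
  · exact prop6Printed_zdCub_of_sockD4βFamily₃ (𝔸 := 𝔸) hd2 hL hBbd hcP9 hB₀' hC₂ hcP hall SP5base SP5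

#print axioms prop6Printed_zdCub_of_thm33β₃_hall

/-- ★ **THE RECORD FORM WITHOUT THE UNIQUENESS SOCKET**: `prop6Printed_zdCub_of_thm33β₃` on NODE 00's member of record `Node00.cubB8OfRecord θ`
(`f := Subtype.val` on `Node00.IdxB8 θ`): `∃ B₀ˢ ≥ 1` first, then for all `B₀′, cP > 0` and Proposition 5's TWO EXISTENCE sockets at `(B₀ˢ, B₀′, cP)` on the
cube sub-family, `∃ c₁ > 0` with `B8.Prop6Printed θ.D θ.L (5dL·B₀ˢ) c₁ (cubB8OfRecord θ)` — the `p6` letter for dag-n05-d's T3 (`…N05SubBHKnitUnivOfThm33P6Beta`)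
with the unprovidable `SockP5u` conjunct GONE from its `hSP5C`.  A6 line as in `B8Prop6CubeMemberOfThm33Beta` §1.
[cite: Balaban1985RegularSpaces, Prop. 6 p.99, Thm 4 p.88, Prop. 3 p.87, Prop. 5 (1.107)–(1.108) p.94, (1.59) p.86; Balaban1985BackgroundPropagators, Thm 3.3 p.399] -/
theorem prop6Printed_cubB8OfRecord_of_thm33β₃ (θ : Node00.Stage3Params) (hD : 2 ≤ θ.D)
    {I : Type} (geo : I → B9.Geometry) (bg : I → B9.Backgrounds) (GA : ∀ i, B9.KernelFamily (geo i) (bg i))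
    (mem : ℝ → ZdIdx θ.D θ.L → ℕ → I)
    (ιCfg : ∀ (M : ℝ) (i : ZdIdx θ.D θ.L) (m : ℕ) (U₀ : Site θ.D → Fin θ.D → θ.𝔸ˣ), (∀ x κ, U₀ x κ ∈ unitaryUnits θ.𝔸) →
      (bg (mem M i m)).Cfg)
    (ιLoc : ∀ (M : ℝ) (i : ZdIdx θ.D θ.L) (m : ℕ), (Site θ.D → Fin θ.D → θ.𝔸) → (geo (mem M i m)).Loc)
    (ops : ℝ → ZdIdx θ.D θ.L → ℕ → OpsZd θ.D θ.𝔸) {c35 c₆ K₆ M₃ a₃ c69 q : ℝ}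
    {Gp : ∀ i, B9.KernelFamily (geo i) (bg i)} (h33 : B9.Thm33Printed c35 geo bg Gp GA)
    (hdict : ∀ (M : ℝ) (j : {i : ZdIdx θ.D θ.L // ∃ (a : Site θ.D) (M ρ : ℕ), θ.L ≤ ρ ∧ ρ ≤ M ∧ 11 * θ.D < M ∧ θ.L ≤ θ.D * M ∧
          i.Ω = cubeFam false θ.L a M ρ i.k ∧ i.Λs = cubeLamS θ.L a M ρ i.k ∧ i.Λb = cubeLamB θ.L a M ρ i.k}) (m : ℕ),
      DictAt geo bg GA θ.L mem ιCfg ιLoc ops M j.1 m)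
    (hP6 : ∀ (M : ℝ) (j : {i : ZdIdx θ.D θ.L // ∃ (a : Site θ.D) (M ρ : ℕ), θ.L ≤ ρ ∧ ρ ≤ M ∧ 11 * θ.D < M ∧ θ.L ≤ θ.D * M ∧
          i.Ω = cubeFam false θ.L a M ρ i.k ∧ i.Λs = cubeLamS θ.L a M ρ i.k ∧ i.Λb = cubeLamB θ.L a M ρ i.k}) (m : ℕ),
      M₃ ≤ M → Prop6At bg θ.L mem ιCfg c35 c₆ K₆ M j.1 m)
    (hinv : ∀ (M : ℝ) (j : {i : ZdIdx θ.D θ.L // ∃ (a : Site θ.D) (M ρ : ℕ), θ.L ≤ ρ ∧ ρ ≤ M ∧ 11 * θ.D < M ∧ θ.L ≤ θ.D * M ∧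
          i.Ω = cubeFam false θ.L a M ρ i.k ∧ i.Λs = cubeLamS θ.L a M ρ i.k ∧ i.Λb = cubeLamB θ.L a M ρ i.k}) (m : ℕ),
      M₃ ≤ M → InvAt bg θ.L mem ιCfg ops c35 a₃ M j.1 m)
    (hcurv : ∀ (M : ℝ) (j : {i : ZdIdx θ.D θ.L // ∃ (a : Site θ.D) (M ρ : ℕ), θ.L ≤ ρ ∧ ρ ≤ M ∧ 11 * θ.D < M ∧ θ.L ≤ θ.D * M ∧
          i.Ω = cubeFam false θ.L a M ρ i.k ∧ i.Λs = cubeLamS θ.L a M ρ i.k ∧ i.Λb = cubeLamB θ.L a M ρ i.k}) (m : ℕ),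
      M₃ ≤ M → CurvAt bg θ.L mem ιCfg ops c35 a₃ c69 M j.1 m)
    (hlan : ∀ (M : ℝ) (j : {i : ZdIdx θ.D θ.L // ∃ (a : Site θ.D) (M ρ : ℕ), θ.L ≤ ρ ∧ ρ ≤ M ∧ 11 * θ.D < M ∧ θ.L ≤ θ.D * M ∧
          i.Ω = cubeFam false θ.L a M ρ i.k ∧ i.Λs = cubeLamS θ.L a M ρ i.k ∧ i.Λb = cubeLamB θ.L a M ρ i.k}) (m : ℕ),
      M₃ ≤ M → LandauAt bg θ.L mem ιCfg ops c35 a₃ M j.1 m)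
    (havg : ∀ (M : ℝ) (j : {i : ZdIdx θ.D θ.L // ∃ (a : Site θ.D) (M ρ : ℕ), θ.L ≤ ρ ∧ ρ ≤ M ∧ 11 * θ.D < M ∧ θ.L ≤ θ.D * M ∧
          i.Ω = cubeFam false θ.L a M ρ i.k ∧ i.Λs = cubeLamS θ.L a M ρ i.k ∧ i.Λb = cubeLamB θ.L a M ρ i.k}) (m : ℕ),
      AvgAtβ θ.L ops q M j.1 m)
    (hc₆ : 0 < c₆) (hK₆ : 0 < K₆) (ha₃ : 0 < a₃) (hc69 : 0 ≤ c69) (hq : 0 ≤ q) :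
    ∃ B₀S : ℝ, 1 ≤ B₀S ∧ ∀ {B₀' cP : ℝ}, 0 < B₀' → 0 < cP →
      ((∀ i : {i : ZdIdx θ.D θ.L // ∃ (a : Site θ.D) (M ρ : ℕ), θ.L ≤ ρ ∧ ρ ≤ M ∧ 11 * θ.D < M ∧ θ.L ≤ θ.D * M ∧
          i.Ω = cubeFam false θ.L a M ρ i.k ∧ i.Λs = cubeLamS θ.L a M ρ i.k ∧ i.Λb = cubeLamB θ.L a M ρ i.k},
          SockP5base (𝔸 := θ.𝔸) θ.L B₀S B₀' cP i.1.η i.1.k i.1.Ω i.1.Λs) →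
       (∀ i : {i : ZdIdx θ.D θ.L // ∃ (a : Site θ.D) (M ρ : ℕ), θ.L ≤ ρ ∧ ρ ≤ M ∧ 11 * θ.D < M ∧ θ.L ≤ θ.D * M ∧
          i.Ω = cubeFam false θ.L a M ρ i.k ∧ i.Λs = cubeLamS θ.L a M ρ i.k ∧ i.Λb = cubeLamB θ.L a M ρ i.k},
          SockP5 (𝔸 := θ.𝔸) θ.L B₀S B₀' cP i.1.η i.1.k i.1.Ω i.1.Λs) →
       ∃ c₁ : ℝ, 0 < c₁ ∧
         B8.Prop6Printed θ.D (θ.L : ℝ) (5 * (θ.D : ℝ) * θ.L * B₀S) c₁ (Node00.cubB8OfRecord θ)) := by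
  obtain ⟨B₀S, hB₀S, H⟩ := prop6Printed_zdCub_of_thm33β₃ (𝔸 := θ.𝔸) hD θ.two_le_L geo bg GA mem ιCfg ιLoc ops h33 hdict hP6
    hinv hcurv hlan havg hc₆ hK₆ ha₃ hc69 hq
  refine ⟨B₀S, hB₀S, fun hB₀' hcP SP5base SP5 => ?_⟩
  obtain ⟨c₁, hc₁, G⟩ := H hB₀' hcP SP5base SP5
  exact ⟨c₁, hc₁, G (fun i : Node00.IdxB8 θ => i.1)⟩

#print axioms prop6Printed_cubB8OfRecord_of_thm33β₃

end Literature.MathematicalPhysics.QuantumFieldTheory.Balaban1983to89.B8Prop6CubeMemberOfThm33BetaExists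

end

/-! ## HONEST SCOPE — VACUOUS AS TYPED (2026-08-27, seat `pub-ymgap-dag-n05-e` g9; director-ym LINE №196, dag-lead DEDUP-349∕350)

Every theorem of this file whose hypotheses contain a (1.59)-type clause or socket in EDITION β at a CUBE MEMBER of (1.131) — the SCALAR clauses
SC2∕SC4, the 𝔸-valued sockets `SockB9P3D4β` ∕ `H59Dβ` ∕ the four-line Prop.-3-frame socket, or a hypothesis SET that yields them (`B9.Thm33Printed` +
dag-n06-b's member-local binders at every truncation) — is VACUOUS AS TYPED: the averaging datum is read over `B8CubeMemberZd.cubeLamB`, whose condition 1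
«fine box ⊂ □_j» EMPTIES print's crossing bonds of (1.31) at levels `j ≥ 1`, and the interior SHELL GAUGE MODES `∂(𝟙λ)`, `λ ⊂ □_j`, then defeat the clause at
every cube member with `k ≥ 1` for ALL constants `B₀, B_∂` — KERNEL CERTIFICATE dag-n05-c `B8Ineq159FlatShellModeVacuity` (p572834:
`not_flat159β_two_cubeMember(_one)`, `sc2_uninhabited_cubeB8`; ref-E g12 READ-11 A6-FINAL), `Ω₀ = ℤᵈ` twin `…ShellModeVacuityUniv` (p576185).  The theorems
stay TRUE and PASS-AS-DECLARED; their content at cube members is nil.  Nothing of [Balaban1985RegularSpaces] is refuted: print's class ([B6] (2.3), «at least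
one end-point in Ω_j^{(j)}») contains the crossing bonds and kills the modes (dag-n05-c `B8Ineq159FlatShellModeCrossingDatum`).  SUPERSEDED BY EDITION γ: the
datum class of record becomes dag-n05-c's `B8Ineq159FlatCubeMemberPrinted.cubeLamBP` (p573921∕p575549), the socket dag-n06-b's `B9SupplySockB9P3ZdGamma`, the
Theorem-4 driver this seat's `B8Eq142KLevelLocalGamma` ∕ `B8Thm4KLevelGamma`; this file is kept as history and for its class-independent mechanics
(composition shape, ⊗-id transfer, the level-0 crossing MOVE), re-run by token swap in γ.  Count-neutral; N05 NOT discharged; nothing continuum ∕ ℝ⁴ ∕ OS ∕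
mass-gap ∕ Clay. -/
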